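import Summits.CriticalPhenomena.PercolationContinuityZ3.Theorems.Transplant.AutChartOrbitsDatum
import Literature.GroupTheory.Nilpotent.GrowthFiniteIndexTransfer
import HarnessLib

/-!
# Growth transfer along a COCOMPACT action: finitely many orbits of a group `K` acting by automorphisms force
# `|B_X(x,n)| ≤ |reps| · |B_{Cay(K;S)}(1,n)|` for a finite `S ⊆ K`

builds on p205010 (kernel theorem, internal audit signed; external expert review pending) — nothing in this file uses p205010; nothing here is about
percolation and NOTHING is claimed about any node.  Lane `prim-bschramm`, seat `prim-bschramm-gen-1` gen 6 (GEN pen; §P of the Wolf/Bass follow-up: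
the growth hypothesis `hpoly` of `AutCyl.conj4_of_free_nilpotent_of_endStateCyl` is redundant for NILPOTENT `K` once Wolf's theorem is in the tree).
Helper file (`--supports stmt-CriticalPhenomena-4575 --as helper`); PROOFS ONLY (def-free).

THE ARGUMENT (p5 gen 28's «AutCylinderZdPeriodic» §1 with `ℤ^d` replaced by an arbitrary group and the coordinate box by a word ball).  Let `K` act on the
connected locally finite graph `X` by automorphisms with finitely many orbits, `reps` meeting every orbit (`hcover`), `osec w • otyp w = w` the chosen
sections/types («AutChartOrbitsDatum»).  Put `S := {osec w : w ∼ r, r ∈ reps}` — a FINITE subset of `K`.  Along a walk `b • r₀ = z₀ ∼ z₁ ∼ ⋯ ∼ z_ℓ`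
one has `z_i = (b a_i) • r_i` with `r_i ∈ reps` and `a_{i+1} = a_i · osec(w_i)` for the neighbour `w_i := (b a_i)⁻¹ • z_{i+1}` of `r_i`; so `a_ℓ` is a
product of `ℓ` elements of `S`, i.e. `a_ℓ ∈ B_{Cay(K;S)}(1, ℓ)` (`exists_coords_of_mem_support_mulCayley`).  Hence `(a, r) ↦ (b a) • r` maps
`B_S(1,n) × reps` ONTO `B_X(b • r₀, n)` and **`|B_X(x,n)| ≤ |reps| · |B_S(1,n)|`** (`exists_finset_ballVolume_le_card_mul`).  Freeness is not used.
With Wolf's theorem for nilpotent `K` (Literature «PolynomialGrowthVirtuallyNilpotent» §2) this discharges `hpoly` for free cocompact NILPOTENT actions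
(sequel / customer «AutCocompactWolf»).
[cite: BenjaminiSchramm1996, §2 (almost transitive graphs)] [cite: Woess2000, Prop. 3.9 and Lemma 3.13 (quasi-transitive graphs are roughly isometric to Cayley graphs of cocompact groups; equivalent growth)]
-/

noncomputable section

namespace Summit.CriticalPhenomena.PercolationContinuityZ3.Theorems.Transplant

open SimpleGraph Literature.Barriers.CriticalPhenomena Literature.Probability.Percolation Literature.GroupTheory.Nilpotent
open scoped Classical

namespace AutChart

section CocompactGrowth

variable {W : Type} {X : SimpleGraph W} {K : Type} [Group K] [MulAction K W]

/-- **Word coordinates along a walk.**  If `b • r₀` starts a walk of length `ℓ` (`r₀ ∈ reps`) and `S ⊆ K` contains the section `osec w` of every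
neighbour `w` of every representative, then every vertex of the walk is `(b a) • r` with `r ∈ reps` and `a ∈ B_{Cay(K;S)}(1, ℓ)`.
[cite: Woess2000, Prop. 3.9 (proof: cocompact actions and word lengths)] -/
theorem exists_coords_of_mem_support_mulCayley (hact : IsActionByAut X K) {reps : Finset W}
    (hcover : ∀ w : W, ∃ k : K, ∃ r ∈ reps, k • r = w) {S : Finset K}
    (hS : ∀ r ∈ reps, ∀ w : W, X.Adj r w → osec hcover w ∈ S) :
    ∀ {u v : W} (p : X.Walk u v) (b : K) (r₀ : W), r₀ ∈ reps → b • r₀ = u →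
      ∀ z ∈ p.support, ∃ (a : K) (r : W), r ∈ reps ∧ (b * a) • r = z ∧ a ∈ graphBall (mulCayley (↑S : Set K)) 1 p.length
  | u, _, Walk.nil, b, r₀, hr₀, hb => by
    intro z hz
    rw [Walk.support_nil, List.mem_singleton] at hz
    subst hz
    exact ⟨1, r₀, hr₀, by rw [mul_one, hb], mem_graphBall_self _ _ _⟩
  | u, v, Walk.cons (v := u') h p, b, r₀, hr₀, hb => by
    intro z hz
    rw [Walk.support_cons, List.mem_cons] at hz
    rcases hz with rfl | hz
    · exact ⟨1, r₀, hr₀, by rw [mul_one, hb], mem_graphBall_self _ _ _⟩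
    · -- pull the first edge back to the representative `r₀`
      have hadj : X.Adj r₀ (b⁻¹ • u') := by
        have h' := (hact b⁻¹ u u').2 h
        rwa [← hb, inv_smul_smul] at h'
      set w := b⁻¹ • u' with hw
      have hw' : (b * osec hcover w) • otyp hcover w = u' := by
        rw [mul_smul, osec_smul, hw, smul_inv_smul]
      obtain ⟨a', r, hr, hz', ha'⟩ :=
        exists_coords_of_mem_support_mulCayley hact hcover hS p (b * osec hcover w) (otyp hcover w) (otyp_mem hcover w) hw' z hz
      refine ⟨osec hcover w * a', r, hr, by rw [← hz', mul_assoc], ?_⟩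
      rw [Walk.length_cons, add_comm]
      exact mul_mem_graphBall_mulCayley (mem_graphBall_mulCayley_one (Or.inl (Finset.mem_coe.2 (hS r₀ hr₀ w hadj)))) ha'

variable [X.LocallyFinite]

/-- **GROWTH TRANSFER ALONG A COCOMPACT ACTION**: if `K` acts on the locally finite graph `X` by automorphisms with finitely many orbits (`reps` meets
every orbit), there is a FINITE `S ⊆ K` with `|B_X(x,n)| ≤ |reps| · |B_{Cay(K;S)}(1,n)|` for every vertex `x` and every `n`.
[cite: Woess2000, Prop. 3.9 and Lemma 3.13] [cite: BenjaminiSchramm1996, §2 (almost transitive graphs)] -/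
theorem exists_finset_ballVolume_le_card_mul (hact : IsActionByAut X K) (reps : Finset W)
    (hcover : ∀ w : W, ∃ k : K, ∃ r ∈ reps, k • r = w) :
    ∃ S : Finset K, ∀ (x : W) (n : ℕ), ballVolume X x n ≤ reps.card * ballVolume (mulCayley (↑S : Set K)) 1 n := by
  let S : Finset K := reps.biUnion fun r => (X.neighborFinset r).image (osec hcover)
  have hS : ∀ r ∈ reps, ∀ w : W, X.Adj r w → osec hcover w ∈ S := fun r hr w hw =>
    Finset.mem_biUnion.2 ⟨r, hr, Finset.mem_image.2 ⟨w, (X.mem_neighborFinset r w).2 hw, rfl⟩⟩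
  refine ⟨S, fun x n => ?_⟩
  obtain ⟨b, r₀, hr₀, hb⟩ := hcover x
  -- the ball is covered by the image of `B_S(1,n) × reps`
  have hsub : graphBall X x n ⊆
      (fun q : K × W => (b * q.1) • q.2) '' (graphBall (mulCayley (↑S : Set K)) 1 n ×ˢ (↑reps : Set W)) := by
    intro z hz
    obtain ⟨p, hp⟩ := hz
    obtain ⟨a, r, hr, hz', ha⟩ := exists_coords_of_mem_support_mulCayley hact hcover hS p b r₀ hr₀ hb z p.end_mem_support
    exact ⟨(a, r), Set.mk_mem_prod (graphBall_mono _ _ hp ha) (Finset.mem_coe.2 hr), hz'⟩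
  have hfin : (graphBall (mulCayley (↑S : Set K)) 1 n ×ˢ (↑reps : Set W)).Finite :=
    (graphBall_mulCayley_finite S 1 n).prod reps.finite_toSet
  calc ballVolume X x n
      ≤ ((fun q : K × W => (b * q.1) • q.2) '' (graphBall (mulCayley (↑S : Set K)) 1 n ×ˢ (↑reps : Set W))).ncard :=
        Set.ncard_le_ncard hsub (hfin.image _)
    _ ≤ (graphBall (mulCayley (↑S : Set K)) 1 n ×ˢ (↑reps : Set W)).ncard := Set.ncard_image_le hfin
    _ = reps.card * ballVolume (mulCayley (↑S : Set K)) 1 n := by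
        rw [Set.ncard_prod, Set.ncard_coe_finset, ballVolume, mul_comm]

/-- **Polynomial growth transfers along a cocompact action**, in the `∃ C D` currency: if for the finite `S ⊆ K` of the previous theorem — indeed for
EVERY finite `S ⊆ K` — the Cayley balls grow polynomially, then so does `X`, uniformly in the base point.  (Used with Wolf's theorem for nilpotent `K`.)
[cite: Woess2000, Lemma 3.13] -/
theorem exists_polynomialGrowth_of_cocompact (hact : IsActionByAut X K) (reps : Finset W)
    (hcover : ∀ w : W, ∃ k : K, ∃ r ∈ reps, k • r = w)
    (hK : ∀ S : Finset K, ∃ C D : ℕ, ∀ n : ℕ, ballVolume (mulCayley (↑S : Set K)) 1 n ≤ C * (n + 1) ^ D) :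
    ∃ (C : ℝ) (D : ℕ), ∀ (x : W) (n : ℕ), (ballVolume X x n : ℝ) ≤ C * ((n : ℝ) + 1) ^ D := by
  obtain ⟨S, hS⟩ := exists_finset_ballVolume_le_card_mul hact reps hcover
  obtain ⟨C, D, hCD⟩ := hK S
  refine ⟨(reps.card : ℝ) * C, D, fun x n => ?_⟩
  have h : ballVolume X x n ≤ reps.card * (C * (n + 1) ^ D) := (hS x n).trans (Nat.mul_le_mul_left _ (hCD n))
  have h' : (ballVolume X x n : ℝ) ≤ (reps.card : ℝ) * ((C : ℝ) * (((n : ℝ) + 1) ^ D)) := by exact_mod_cast h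
  linarith [h']

end CocompactGrowth

end AutChart

end Summit.CriticalPhenomena.PercolationContinuityZ3.Theorems.Transplant

end
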